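import Literature.AlgebraicGeometry.HodgeTheory.WeilClassesCyclicPrymTyping
import Literature.AlgebraicGeometry.HodgeTheory.AbelianVarietyHOneExactness
import Literature.AlgebraicGeometry.Motives.ComplexPointsOrientation
import Literature.AlgebraicGeometry.Motives.ComplexPointsManifold
import Literature.AlgebraicGeometry.Motives.JacobianFiniteIndex
import Literature.AlgebraicGeometry.Motives.JacobianBasePoint
import Literature.AlgebraicGeometry.Motives.JacobianDimensionProofs
import Literature.Topology.FourManifolds.ComplexProjectiveSpaceCohomology
import Literature.AlgebraicTopology.SingularHomology.CupProduct
import Literature.AlgebraicTopology.SingularHomology.LoopClassesSpan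
import Literature.AlgebraicTopology.SingularHomology.KroneckerDualMap
import Literature.AlgebraicTopology.SingularHomology.BettiNumberBaseChange
import Mathlib.LinearAlgebra.Trace
import HarnessLib

/-!
# Schoen's primitive Prym has dimension `8`: Chevalley–Weil bookkeeping for the étale `ℤ/6`-cover, and Schoen's fact from its two remaining inputs

Family `hodge`, layer `Literature/AlgebraicGeometry/HodgeTheory`; third file of the story
`WeilClassesCyclicPrym` (the named fact `Schoen1988_cyclicPrym_weilClasses_algebraic_degreeSix` and its
endomorphism dictionary) → `WeilClassesCyclicPrymTyping` (the fact ⟺ "the Weil plane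
`weilClassesOf B ψ₀ 4 3` is algebraic"; the fact ⟸ `dim B = 8` ∧ ONE non-zero algebraic class in `E₊`)
→ this file: **`dim B = 8`** for Schoen's primitive Prym `B = (Ker (𝟙 - α_* + α_*²))⁰ ⊂ J(C)` of an
étale `ℤ/6`-cover `C → C/⟨α⟩` of a genus-`5` curve (`g(C) = 25`), on the tree's REAL carriers, from
exactly two inputs taken as hypotheses — (i) the named fact
`Motives.isIso_bettiCohomology_map_abelJacobi` (`H¹(J(C)) ≅ H¹(C)`; Lange 2023 §4.1.1) and (ii) the
vanishing of the LEFSCHETZ NUMBERS of the fixed-point-free maps `α, …, α⁵` on `C(ℂ)` (the Lefschetz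
fixed-point theorem, Hatcher Thm. 2C.3, NOT in the tree) — and the resulting assembly
`Schoen1988_cyclicPrym_weilClasses_algebraic_degreeSix_of_isIso_of_lefschetz_of_exists`:
**Schoen's fact follows from (i), (ii) and Schoen's cycle (ONE non-zero algebraic class in `E₊`).**
Everything here is PROVED; no named fact, no definition is introduced.

## The printed argument (Patel–Zhang 2025, Lemma 2.9 and Lemma 5.1; Schoen 1988, Lemma 1.5, §3 p. 24)

For an étale cyclic cover `C → C''` with group `G = ⟨α⟩ ≅ ℤ/n` of a genus-`q` curve, `h := 2q - 2`:
"`dim H¹(C', L_χ) = 2g - 2`" for every non-trivial character `χ` (PZ Lemma 2.9, by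
`χ_top(C', L_χ) = χ_top(C') = 2 - 2g` and `H⁰ = H² = 0`), i.e. (Chevalley–Weil) every non-trivial
character of `G` occurs in `H¹(C, ℂ)` with multiplicity `h`, and "`H¹(B_prim, ℚ)` is a
`ℚ(μ_n)`-vector space in which every primitive character occurs with multiplicity `h`" (PZ Lemma 5.1),
so `dim B_prim = h · φ(n) / 2`; here `n = 6`, `q = 5`, `h = 8`, `dim B = 8 · 2 / 2 = 8`.

## The proof on the carriers

* §1 (linear algebra) `six_mul_finrank_ker_cyclotomic₆`: for `T⁶ = 1` on a finite-dimensional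
  `ℂ`-space, `6 · dim ker (1 - T + T²) = 2 dim V + tr T - tr T² - 2 tr T³ - tr T⁴ + tr T⁵` — the
  character count `n_{ζ₆} + n_{ζ₆⁻¹} = ⟨χ_T, χ_{ζ₆} + χ_{ζ₆⁻¹}⟩`, proved WITHOUT eigenvalues as the
  trace of the explicit projector `P = (2 + T - T² - 2T³ - T⁴ + T⁵)/6` onto `ker Φ₆(T)`
  (`isProj_ker_cyclotomic₆`: `Φ₆ · 6P = (T - 2)(T⁶ - 1) = 0`, `6P = (T³ - 3T - 4)Φ₆(T) + 6`); hence
  `finrank_ker_cyclotomic₆_eq_sixteen`: `dim V = 50` and `tr Tʲ = 1 + λʲ` (`λ² = 1`, `j = 1…5`) give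
  `dim ker Φ₆(T) = 16`. Also `trace_pow_eq_of_comp_eq` (intertwined endomorphisms have equal traces of
  powers) and `trace_pow_of_finrank_eq_one`.
* §2 (the curve) for `X` smooth projective and `f : X ⟶ X`: `f^* = id` on `H⁰(X(ℂ); ℂ) = ℂ`
  (`complexBetti_map_zero_hom_eq_id`, `trace_pow_complexBetti_map_zero`), the trace of `f^*` on every
  `Hᵏ(X(ℂ); ℂ)` is RATIONAL (`trace_complexBetti_map_mem_range_ratCast`: rational classes span, and have
  rational coordinates in a rational basis — the tree's `repr_mem_range_ratCast_of_isRationalClass`); for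
  a curve `dim H²(C(ℂ); ℂ) = 1` (`finrank_complexBetti_two_of_curve`, Poincaré duality `b₂ = b₀`), so
  `α^*` acts on `H²` by a rational scalar `l` with `l⁶ = 1` when `α⁶ = 𝟙`, whence **`l² = 1`**
  (`sq_trace_complexBetti_map_two_eq_one`; in truth `l = +1`, not needed).
* §3 (the Jacobian) `(f^P)^* ∘ (α_*)^* = α^* ∘ (f^P)^*` on `Hⁱ` (Lange's square `N_α ∘ f^P = f^{α P} ∘ α`,
  the tree's `Jacobian.abelJacobi_comp_pushforward`, and independence of the base point — translations
  are homotopic to the identity, `complexBetti_map_abelJacobi_eq`); granted (i), `(f^P)^*` is bijective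
  on `H¹` with `ℂ`-coefficients (`bijective_complexBetti_map_abelJacobi`: injective unconditionally by the
  tree's finite-index theorem `index_range_map_abelJacobi_ne_zero`, dimensions equal by (i) and universal
  coefficients), so **`tr((α_*^*)ʲ | H¹(J)) = tr((α^*)ʲ | H¹(C))`**
  (`trace_pow_complexBetti_map_pushforward_eq`).
* §4 `dim_kerComponent_cyclotomic₆_pushforward_eq_eight`: `2 dim B = dim ker (1 - S + S²)`
  (`two_mul_dim_kerComponent_eq_finrank_ker` of `AbelianVarietyHOneExactness`, `S = α_*^*`), `S⁶ = 1`,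
  `dim H¹(J) = 50`, and by (ii) + §2 `tr Sʲ = tr((α^*)ʲ|H¹(C)) = tr(H⁰) + tr(H²) = 1 + lʲ`; §1 gives `16`,
  so `dim B = 8`. With `…_of_dim_eq_eight_of_exists` of the typing file:
  `Schoen1988_cyclicPrym_weilClasses_algebraic_degreeSix_of_isIso_of_lefschetz_of_exists`.

* §3b `lefschetz_traces_of_pow_six`: the curve-specific hypothesis `hL` (vanishing of
  `tr(H⁰) - tr(H¹) + tr(H²)` for `(α^*)ʲ`, `j = 1, …, 5`) FOLLOWS from the Lefschetz fixed point theorem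
  for compact manifolds in Hatcher's form (Thm. 2C.3 with Ex. 2C.7 and Cor. A.9; hypothesis `hLFT`,
  spelled out verbatim: a fixed-point-free self-map of a compact Hausdorff `n`-manifold has
  `Σ_{k ≤ n} (-1)ᵏ tr(f^*|Hᵏ(M; ℂ)) = 0`) applied to the closed surface `C(ℂ)` and the maps `αʲ(ℂ)`,
  which are fixed-point free because `α²`, `α³` are and `α⁶ = 𝟙`; whence
  `Schoen1988_cyclicPrym_weilClasses_algebraic_degreeSix_of_isIso_of_lefschetzFixedPoint_of_exists`.

What is NOT here (and not in the tree): the Lefschetz fixed point theorem itself (hypothesis `hLFT`; a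
classical theorem which a proving unit may not mint as a named fact, D-0026), the named fact (i), and
Schoen's cycle (hypothesis `hZ`; Schoen Thm. 2.0 / Cor. 3.1, Patel–Zhang Prop. 3.2–Thm. 4.4: symmetric
powers of curves, the Abel–Jacobi projective bundle, the class-field-theory square).

## References

* [PatelZhang2025PrymHodge] D. Patel, Z. Zhang, arXiv:2506.13729 (2025), Lemma 2.9 (p. 6),
  Lemma 5.1 and Def. 5.2 (p. 12), Thm 5.3.
* [Schoen1988HodgeWeil] C. Schoen, Hodge classes on self-products of a variety with an automorphism,
  Compositio Math. 65 (1988), Lemma 1.5, Thm. 2.0 (p. 11), §3 p. 24 and Cor. 3.1.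
* [Lange2023AbelianVarietiesC] H. Lange, Abelian Varieties over the Complex Numbers (2023), §4.1.1,
  Lemma 4.4.1, §4.5.2.
* [HatcherAT2002] A. Hatcher, Algebraic Topology (2002), §2.C Thm. 2C.3 (Lefschetz fixed point
  theorem), §3.1 p. 199, p. 201, Thm. 3.2, Prop. 3.10, §3.3 Cor. 3.37.
* [LangeBirkenhake1992] H. Lange, Ch. Birkenhake, Complex Abelian Varieties (1992), §1.1.
-/

noncomputable section

open Polynomial Module

namespace Literature.AlgebraicGeometry.HodgeTheory

/-! ### §1 Linear algebra: the multiplicity of the primitive sixth roots of unity from traces -/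

section LinearAlgebra

variable {V : Type*} [AddCommGroup V] [Module ℂ V]

/-- `Φ₆ · (2 + X - X² - 2X³ - X⁴ + X⁵) = (X - 2)(X⁶ - 1)`. [folklore] -/
theorem cyclotomic₆_mul_sixIdempotent :
    ((X : ℂ[X]) ^ 2 - X + 1) * (2 + X - X ^ 2 - 2 * X ^ 3 - X ^ 4 + X ^ 5) =
      (X - 2) * (X ^ 6 - 1) := by
  ring

/-- `(2 + X - X² - 2X³ - X⁴ + X⁵) = (X³ - 3X - 4) · Φ₆ + 6`. [folklore] -/
theorem sixIdempotent_eq :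
    (2 + X - X ^ 2 - 2 * X ^ 3 - X ^ 4 + X ^ 5 : ℂ[X]) = (X ^ 3 - 3 * X - 4) * (X ^ 2 - X + 1) + 6 := by
  ring

/-- **The projector onto `ker Φ₆(T)` for `T⁶ = 1`.** For an endomorphism `T` with `T⁶ = 1` of a
complex vector space, `P = (2 + T - T² - 2T³ - T⁴ + T⁵)/6` (the sum `e_{ζ₆} + e_{ζ₆⁻¹}` of the two
primitive idempotents of `ℂ[ℤ/6]` at the primitive sixth roots of unity: its coefficients are
`(ζ₆^{-j} + ζ₆^{j})/6 = 2cos(πj/3)/6`) is a projection onto `ker (1 - T + T²)`. [folklore] -/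
theorem isProj_ker_cyclotomic₆ (T : Module.End ℂ V) (hT : T ^ 6 = 1) :
    LinearMap.IsProj (LinearMap.ker (1 - T + T ^ 2))
      ((6 : ℂ)⁻¹ • (2 + T - T ^ 2 - 2 * T ^ 3 - T ^ 4 + T ^ 5)) := by
  -- everything happens in the commutative subalgebra `ℂ[T]`
  have hΦ : (1 - T + T ^ 2 : Module.End ℂ V) = aeval T ((X : ℂ[X]) ^ 2 - X + 1) := by
    simp [map_add, map_sub]; abel
  have hE : (2 + T - T ^ 2 - 2 * T ^ 3 - T ^ 4 + T ^ 5 : Module.End ℂ V) =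
      aeval T (2 + X - X ^ 2 - 2 * X ^ 3 - X ^ 4 + X ^ 5 : ℂ[X]) := by
    simp [map_add, map_sub, map_ofNat]
  have h6 : aeval T ((X : ℂ[X]) ^ 6 - 1) = 0 := by simp [hT]
  constructor
  · -- `Φ₆(T) (P x) = 0`
    intro x
    rw [LinearMap.mem_ker, LinearMap.smul_apply, map_smul, hΦ, hE, ← Module.End.mul_apply,
      ← map_mul, cyclotomic₆_mul_sixIdempotent, map_mul, h6, mul_zero, LinearMap.zero_apply,
      smul_zero]
  · -- `P x = x` for `Φ₆(T) x = 0`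
    intro x hx
    rw [LinearMap.mem_ker, hΦ] at hx
    have h : (aeval T (2 + X - X ^ 2 - 2 * X ^ 3 - X ^ 4 + X ^ 5 : ℂ[X])) x = (6 : ℂ) • x := by
      rw [sixIdempotent_eq, map_add, map_mul, LinearMap.add_apply, Module.End.mul_apply, hx,
        map_zero, zero_add, map_ofNat, Module.End.ofNat_apply, ← Nat.cast_smul_eq_nsmul ℂ,
        Nat.cast_ofNat]
    rw [LinearMap.smul_apply, hE, h, smul_smul, inv_mul_cancel₀ (by norm_num), one_smul]

/-- **Multiplicity of the primitive sixth roots of unity from the traces of the powers.** For an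
endomorphism `T` with `T⁶ = 1` of a finite-dimensional complex vector space `V`,
`6 · dim ker (1 - T + T²) = 2 dim V + tr T - tr T² - 2 tr T³ - tr T⁴ + tr T⁵`
(character orthogonality for `ℤ/6`: `dim ker Φ₆(T) = n_{ζ₆} + n_{ζ₆⁻¹} = ⟨χ_T, χ_{ζ₆} + χ_{ζ₆⁻¹}⟩`,
`(ζ₆^{j} + ζ₆^{-j})_{j=0..5} = (2, 1, -1, -2, -1, 1)`; proved as the trace of the projector of
`isProj_ker_cyclotomic₆`). [folklore] -/
theorem six_mul_finrank_ker_cyclotomic₆ [FiniteDimensional ℂ V] (T : Module.End ℂ V) (hT : T ^ 6 = 1) :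
    (6 : ℂ) * Module.finrank ℂ (LinearMap.ker (1 - T + T ^ 2)) =
      2 * Module.finrank ℂ V + LinearMap.trace ℂ V T - LinearMap.trace ℂ V (T ^ 2) -
        2 * LinearMap.trace ℂ V (T ^ 3) - LinearMap.trace ℂ V (T ^ 4) + LinearMap.trace ℂ V (T ^ 5) := by
  have h := (isProj_ker_cyclotomic₆ T hT).trace
  rw [map_smul, smul_eq_mul] at h
  have h' : LinearMap.trace ℂ V (2 + T - T ^ 2 - 2 * T ^ 3 - T ^ 4 + T ^ 5) =
      (6 : ℂ) * Module.finrank ℂ (LinearMap.ker (1 - T + T ^ 2)) := by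
    rw [← h, ← mul_assoc, mul_inv_cancel₀ (by norm_num), one_mul]
  rw [← h']
  have h2 : (2 : Module.End ℂ V) = (2 : ℂ) • (1 : Module.End ℂ V) := by
    ext x; simp [two_smul]
  have h3 : (2 * T ^ 3 : Module.End ℂ V) = (2 : ℂ) • T ^ 3 := by
    rw [h2, smul_mul_assoc, one_mul]
  rw [h3, h2]
  simp only [map_add, map_sub, map_smul, LinearMap.trace_one, smul_eq_mul]

/-- **The count for Schoen's primitive Prym.** If moreover `dim V = 50` and the traces are
`tr Tʲ = 1 + λʲ` for `j = 1, …, 5` with `λ² = 1` — the traces of the powers of a fixed-point-free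
automorphism of order `6` of a closed surface of genus `25` on `H¹` (Lefschetz: `1 - tr + λʲ = 0`,
`λ = ±1` its action on `H²`) — then `dim ker (1 - T + T²) = 16`. [folklore] -/
theorem finrank_ker_cyclotomic₆_eq_sixteen [FiniteDimensional ℂ V] (T : Module.End ℂ V)
    (hT : T ^ 6 = 1) (hV : Module.finrank ℂ V = 50) {l : ℂ} (hl : l ^ 2 = 1)
    (htr : ∀ j : ℕ, 1 ≤ j → j ≤ 5 → LinearMap.trace ℂ V (T ^ j) = 1 + l ^ j) :
    Module.finrank ℂ (LinearMap.ker (1 - T + T ^ 2)) = 16 := by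
  have h := six_mul_finrank_ker_cyclotomic₆ T hT
  have t1 : LinearMap.trace ℂ V T = 1 + l := by simpa using htr 1 le_rfl (by norm_num)
  have hl3 : l ^ 3 = l := by rw [pow_succ, hl, one_mul]
  have hl4 : l ^ 4 = 1 := by rw [show (4 : ℕ) = 2 * 2 from rfl, pow_mul, hl, one_pow]
  have hl5 : l ^ 5 = l := by rw [pow_succ, hl4, one_mul]
  rw [hV, t1, htr 2 (by norm_num) (by norm_num), htr 3 (by norm_num) (by norm_num),
    htr 4 (by norm_num) (by norm_num), htr 5 (by norm_num) (by norm_num), hl, hl3, hl4, hl5] at h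
  have h' : (6 : ℂ) * Module.finrank ℂ (LinearMap.ker (1 - T + T ^ 2)) = 6 * 16 := by
    rw [h]; push_cast; ring
  exact_mod_cast mul_left_cancel₀ (by norm_num : (6 : ℂ) ≠ 0) h'

end LinearAlgebra

/-! ### Conjugate endomorphisms; endomorphisms of a line -/

section Conjugate

variable {K : Type*} [Field K] {V W : Type*} [AddCommGroup V] [Module K V] [AddCommGroup W] [Module K W]

/-- If `F ∘ S = A ∘ F` then `F ∘ Sʲ = Aʲ ∘ F`. [folklore] -/
theorem comp_pow_eq_pow_comp_of_comp_eq {F : V →ₗ[K] W} {S : Module.End K V} {A : Module.End K W}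
    (h : F ∘ₗ S = A ∘ₗ F) (j : ℕ) : F ∘ₗ (S ^ j) = (A ^ j) ∘ₗ F := by
  induction j with
  | zero => rw [pow_zero, pow_zero, Module.End.one_eq_id, Module.End.one_eq_id, LinearMap.comp_id,
      LinearMap.id_comp]
  | succ j ih =>
      rw [pow_succ, pow_succ, Module.End.mul_eq_comp, Module.End.mul_eq_comp, ← LinearMap.comp_assoc,
        ih, LinearMap.comp_assoc, h, LinearMap.comp_assoc]

/-- **Intertwined endomorphisms have the same traces of powers**: if `F : V → W` is bijective and
`F ∘ S = A ∘ F` then `tr Sʲ = tr Aʲ` for all `j` (`Sʲ = F⁻¹ Aʲ F`). [folklore] -/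
theorem trace_pow_eq_of_comp_eq [FiniteDimensional K V] [FiniteDimensional K W] {F : V →ₗ[K] W}
    (hF : Function.Bijective F) {S : Module.End K V} {A : Module.End K W} (h : F ∘ₗ S = A ∘ₗ F)
    (j : ℕ) : LinearMap.trace K V (S ^ j) = LinearMap.trace K W (A ^ j) := by
  let e : V ≃ₗ[K] W := LinearEquiv.ofBijective F hF
  have he : (e : V →ₗ[K] W) = F := rfl
  have hj := comp_pow_eq_pow_comp_of_comp_eq h j
  have hS : S ^ j = (e.symm : W →ₗ[K] V) ∘ₗ ((A ^ j) ∘ₗ (e : V →ₗ[K] W)) := by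
    rw [he, ← hj, ← LinearMap.comp_assoc, ← he, LinearEquiv.symm_comp, LinearMap.id_comp]
  rw [hS, LinearMap.trace_comp_comm', LinearMap.comp_assoc, LinearEquiv.comp_symm, LinearMap.comp_id]

/-- On a line every endomorphism is the scalar `tr g`: `g = (tr g) • 1`. [folklore] -/
theorem eq_trace_smul_one_of_finrank_eq_one [FiniteDimensional K V] (hV : Module.finrank K V = 1)
    (g : Module.End K V) : g = LinearMap.trace K V g • (1 : Module.End K V) := by
  obtain ⟨v, hv, hspan⟩ := finrank_eq_one_iff'.mp hV
  obtain ⟨c, hc⟩ := hspan (g v)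
  -- `g = c • 1`
  have hg : g = c • (1 : Module.End K V) := by
    ext w
    obtain ⟨d, rfl⟩ := hspan w
    rw [map_smul, ← hc, LinearMap.smul_apply, Module.End.one_apply, smul_comm]
  have htr : LinearMap.trace K V g = c := by
    rw [hg, map_smul, LinearMap.trace_one, hV, Nat.cast_one, smul_eq_mul, mul_one]
  rw [htr, ← hg]

/-- On a line, `tr gʲ = (tr g)ʲ`. [folklore] -/
theorem trace_pow_of_finrank_eq_one [FiniteDimensional K V] (hV : Module.finrank K V = 1)
    (g : Module.End K V) (j : ℕ) :
    LinearMap.trace K V (g ^ j) = LinearMap.trace K V g ^ j := by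
  conv_lhs => rw [eq_trace_smul_one_of_finrank_eq_one hV g, _root_.smul_pow, one_pow, map_smul,
    LinearMap.trace_one, hV, Nat.cast_one, smul_eq_mul, mul_one]

end Conjugate

end Literature.AlgebraicGeometry.HodgeTheory

open CategoryTheory AlgebraicGeometry

namespace Literature.AlgebraicGeometry.HodgeTheory

open Literature.AlgebraicTopology.SingularHomology Literature.AlgebraicGeometry.Motives

/-! ### §2 The curve: traces on `H⁰` and `H²`, rationality of traces -/

section HodgeTheory

variable {n : ℕ} {X : Motives.SchemeOver ℂ}

/-- `Hᵏ(X(ℂ); ℂ)` is finite-dimensional for `X` smooth projective (compact manifold).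
[cite: HatcherAT2002, App. A Cor. A.8–A.9 and §3.1 Cor. 3.3] -/
theorem finite_complexBetti_of_isSmoothProjective (hX : Motives.IsSmoothProjective n X) (k : ℕ) :
    Module.Finite ℂ (complexBetti X k) := by
  letI := hX.chartedSpace
  haveI := ComplexPoints.compactSpace_of_isSmoothProjective hX
  haveI := ComplexPoints.t2Space_of_isSmoothProjective hX
  exact finite_singularCohomology_of_compact_chartedSpace ℂ ℂ (X := Motives.ComplexPoints X) (d := 2 * n) k

/-- `(f ≫ g)^* = g^* ≫ f^*`, linear-map form: `((f ≫ g)^*) = f^* ∘ g^*`. [folklore] -/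
theorem complexBetti_map_comp_hom' {Y Z : Motives.SchemeOver ℂ} (f : X ⟶ Y) (g : Y ⟶ Z) (k : ℕ) :
    (complexBetti.map (f ≫ g) k).hom = (complexBetti.map f k).hom ∘ₗ (complexBetti.map g k).hom := by
  rw [complexBetti.map_comp, ModuleCat.hom_comp]

/-- **Every self-map acts as the identity on `H⁰(X(ℂ); ℂ)`** of a smooth projective (hence
path-connected) `X`: `H⁰ = ℂ · 1` and `f^* 1 = 1`. [cite: HatcherAT2002, §3.1 p. 199 and Prop. 3.10] -/
theorem complexBetti_map_zero_hom_eq_id (hX : Motives.IsSmoothProjective n X) (f : X ⟶ X) :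
    (complexBetti.map f 0).hom = LinearMap.id := by
  haveI := hX.pathConnectedSpace
  ext c
  obtain ⟨a, rfl⟩ :=
    Literature.Topology.FourManifolds.ComplexProjectiveSpace.exists_eq_smul_one (K := ℂ) c
  rw [LinearMap.id_apply, map_smul]
  change a • singularCohomology.map ℂ ℂ (Motives.AlgPoints.mapContinuous (L := ℂ) f) 0
    (singularCohomology.one ℂ (Motives.ComplexPoints X)) = _
  rw [singularCohomology.map_one]

/-- `dim H⁰(X(ℂ); ℂ) = 1` for `X` smooth projective. [cite: HatcherAT2002, §3.1 p. 199] -/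
theorem finrank_complexBetti_zero (hX : Motives.IsSmoothProjective n X) :
    Module.finrank ℂ (complexBetti X 0) = 1 := by
  haveI := hX.pathConnectedSpace
  exact Literature.Topology.FourManifolds.ComplexProjectiveSpace.finrank_singularCohomology_zero

/-- `tr ((f^*)ʲ | H⁰(X(ℂ); ℂ)) = 1` for every self-map `f` of a smooth projective `X`.
[cite: HatcherAT2002, §3.1 p. 199 and Prop. 3.10] -/
theorem trace_pow_complexBetti_map_zero (hX : Motives.IsSmoothProjective n X) (f : X ⟶ X) (j : ℕ) :
    LinearMap.trace ℂ _ ((complexBetti.map f 0).hom ^ j) = 1 := by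
  haveI := finite_complexBetti_of_isSmoothProjective hX 0
  rw [complexBetti_map_zero_hom_eq_id hX, ← Module.End.one_eq_id, one_pow, LinearMap.trace_one,
    finrank_complexBetti_zero hX, Nat.cast_one]

/-- **`dim H²(C(ℂ); ℂ) = 1` for a smooth projective curve** (Poincaré duality `b₂ = b₀` on the closed
oriented surface `C(ℂ)`, and `b₀ = 1`). [cite: HatcherAT2002, §3.3 Cor. 3.37] -/
theorem finrank_complexBetti_two_of_curve {C : Motives.SchemeOver ℂ} (hC : Motives.IsSmoothProjective 1 C) :
    Module.finrank ℂ (complexBetti C 2) = 1 := by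
  rw [← finrank_complexBetti_zero hC]
  exact Motives.ComplexPoints.finrank_singularCohomology_eq_of_add_eq ℂ hC (p := 2) (q := 0) rfl

/-- **The trace of `f^*` on `Hᵏ(X(ℂ); ℂ)` is rational** for every endomorphism `f` of a smooth
projective `X`: in a `ℂ`-basis of rational classes (they span) the matrix of `f^*` is rational.
[folklore] -/
theorem trace_complexBetti_map_mem_range_ratCast (hX : Motives.IsSmoothProjective n X) (f : X ⟶ X)
    (k : ℕ) : LinearMap.trace ℂ _ (complexBetti.map f k).hom ∈ Set.range ((↑) : ℚ → ℂ) := by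
  classical
  haveI := finite_complexBetti_of_isSmoothProjective hX k
  obtain ⟨t, hts, htspan, hli⟩ :=
    exists_linearIndependent ℂ {c : complexBetti X k | IsRationalClass c}
  have hspan : Submodule.span ℂ {c : complexBetti X k | IsRationalClass c} = ⊤ :=
    span_isRationalClass_eq_top_of_isSmoothProjective_holds _ _ hX k
  haveI : Fintype t := (hli.set_finite_of_isNoetherian).fintype
  let b : Module.Basis t ℂ (complexBetti X k) :=
    Module.Basis.mk hli (by rw [Subtype.range_coe, htspan, hspan])
  have hb : ∀ i, IsRationalClass (b i) := fun i => by
    rw [Module.Basis.mk_apply]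
    exact hts i.2
  rw [LinearMap.trace_eq_matrix_trace ℂ b, Matrix.trace]
  have hdiag : ∀ i, LinearMap.toMatrix b b (complexBetti.map f k).hom i i ∈
      Set.range ((↑) : ℚ → ℂ) := fun i => by
    rw [LinearMap.toMatrix_apply]
    exact repr_mem_range_ratCast_of_isRationalClass b hb ((hb i).pullback _) i
  choose q hq using hdiag
  refine ⟨∑ i, q i, ?_⟩
  push_cast
  exact Finset.sum_congr rfl fun i _ => by rw [hq i]; rfl

/-- On the line `H²(C(ℂ); ℂ)` of a smooth projective curve, `tr ((α^*)ʲ) = (tr α^*)ʲ`. [folklore] -/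
theorem trace_pow_complexBetti_map_two_of_curve {C : Motives.SchemeOver ℂ}
    (hC : Motives.IsSmoothProjective 1 C) (α : C ⟶ C) (j : ℕ) :
    LinearMap.trace ℂ _ ((complexBetti.map α 2).hom ^ j) =
      LinearMap.trace ℂ _ (complexBetti.map α 2).hom ^ j := by
  haveI := finite_complexBetti_of_isSmoothProjective hC 2
  -- an endomorphism `g` of a line is the scalar `tr g`
  obtain ⟨v, hv, hspan⟩ := finrank_eq_one_iff'.mp (finrank_complexBetti_two_of_curve hC)
  set g := (complexBetti.map α 2).hom with hg
  obtain ⟨c, hc⟩ := hspan (g v)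
  have hgc : g = c • (1 : Module.End ℂ (complexBetti C 2)) := by
    ext w
    obtain ⟨d, rfl⟩ := hspan w
    rw [map_smul, ← hc, LinearMap.smul_apply, Module.End.one_apply, smul_comm]
  rw [hgc, _root_.smul_pow, one_pow, map_smul, map_smul, LinearMap.trace_one,
    finrank_complexBetti_two_of_curve hC, Nat.cast_one, smul_eq_mul, mul_one, smul_eq_mul, mul_one]

/-- **An automorphism of order dividing `6` acts on `H²(C(ℂ); ℂ)` of a smooth projective curve by
`±1`**: its trace `l` on the line `H²` is rational (`f^*` preserves rational classes) with `l⁶ = 1`,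
hence `l² = 1`. (In fact `l = +1`, the degree of an orientation-preserving self-homeomorphism; not
needed.) [folklore] -/
theorem sq_trace_complexBetti_map_two_eq_one {C : Motives.SchemeOver ℂ}
    (hC : Motives.IsSmoothProjective 1 C) (α : C ⟶ C) (hα : α ≫ α ≫ α ≫ α ≫ α ≫ α = 𝟙 C) :
    LinearMap.trace ℂ _ (complexBetti.map α 2).hom ^ 2 = 1 := by
  haveI := finite_complexBetti_of_isSmoothProjective hC 2
  set l := LinearMap.trace ℂ _ (complexBetti.map α 2).hom with hl
  -- `l⁶ = tr ((α⁶)^*) = tr 1 = 1`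
  have h6 : l ^ 6 = 1 := by
    rw [hl, ← trace_pow_complexBetti_map_two_of_curve hC α 6]
    have e : (complexBetti.map α 2).hom ^ 6 = (complexBetti.map (α ≫ α ≫ α ≫ α ≫ α ≫ α) 2).hom := by
      simp only [complexBetti_map_comp_hom', pow_succ, pow_zero, Module.End.one_eq_id,
        LinearMap.id_comp, Module.End.mul_eq_comp, LinearMap.comp_assoc]
    rw [e, hα, complexBetti.map_id, ModuleCat.hom_id, ← Module.End.one_eq_id, LinearMap.trace_one,
      finrank_complexBetti_two_of_curve hC, Nat.cast_one]
  -- `l` is rational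
  obtain ⟨q, hq⟩ := trace_complexBetti_map_mem_range_ratCast hC α 2
  rw [← hl] at hq
  have hq6 : q ^ 6 = 1 := by exact_mod_cast (show ((q : ℂ)) ^ 6 = 1 by rw [hq, h6])
  have hq2 : q ^ 2 = 1 := by
    have h : (q ^ 2) ^ 3 = 1 := by rw [← pow_mul]; exact hq6
    exact (pow_eq_one_iff_of_nonneg (sq_nonneg q) (by norm_num)).mp h
  rw [← hq]
  exact_mod_cast hq2

end HodgeTheory

end Literature.AlgebraicGeometry.HodgeTheory

namespace Literature.AlgebraicGeometry.HodgeTheory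

open CategoryTheory AlgebraicGeometry
open Literature.AlgebraicTopology.SingularHomology Literature.AlgebraicGeometry.Motives
open scoped MonObj

/-! ### §3 The Jacobian side: `s^* = (α_*)^*` on `H¹(J(ℂ); ℂ)` is conjugate to `α^*` on `H¹(C(ℂ); ℂ)` -/

section JacobianSide

variable {C : Motives.SchemeOver ℂ} (𝒥 : Jacobian C)

/-- **Translations act trivially on `Hⁱ(A(ℂ); ℂ)`** (complex coefficients; the tree's
`AbelianVariety.bettiCohomology_map_mul_const` is the case of `ℚ`): the right translate `f · a` of
`f : X → A` induces the same map as `f`. [cite: HatcherAT2002, §3.1 p. 201] -/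
theorem complexBetti_map_mul_const {A : Motives.AbelianVariety ℂ} {X : Motives.SchemeOver ℂ}
    (f : X ⟶ A.X) (a : A.Points ℂ) (i : ℕ) :
    complexBetti.map (f * (Motives.toSpecOver X ≫ a)) i = complexBetti.map f i := by
  change singularCohomology.map ℂ ℂ (Motives.AlgPoints.mapContinuous (L := ℂ)
    (f * (Motives.toSpecOver X ≫ a))) i = _
  rw [Motives.AbelianVariety.mapContinuous_mul_const, singularCohomology.map_comp,
    singularCohomology.map_eq_of_homotopic' ℂ ℂ (ContinuousMap.homotopic_mulRight_id a) i,
    singularCohomology.map_id, Category.id_comp]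

/-- **`(f^P)^* : Hⁱ(J(ℂ); ℂ) → Hⁱ(C(ℂ); ℂ)` does not depend on the base point** (`f^{P'}` is a
translate of `f^P`, Milne §2). [cite: Milne1986JacobianVarieties, §2 (after the definition of f^P)] -/
theorem complexBetti_map_abelJacobi_eq (P P' : Motives.AlgPoints C ℂ) (i : ℕ) :
    complexBetti.map (𝒥.abelJacobi P') i = complexBetti.map (𝒥.abelJacobi P) i := by
  rw [𝒥.abelJacobi_eq_mul_const P P']
  exact complexBetti_map_mul_const (A := 𝒥.J) (𝒥.abelJacobi P) _ i

/-- **Equivariance of `(f^P)^*`**: for an endomorphism `α` of the curve and its norm map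
`s = α_* = N_α` on the Jacobian (`N_α ∘ f^P = f^{α(P)} ∘ α`, Lange's defining square, and
`(f^{α(P)})^* = (f^P)^*`), `(f^P)^* ∘ s^* = α^* ∘ (f^P)^*` on `Hⁱ`.
[cite: Lange2023AbelianVarietiesC, §4.5.2 (definition of N_f)] -/
theorem complexBetti_map_pushforward_comp_map_abelJacobi (α : C ⟶ C) (P : Motives.AlgPoints C ℂ)
    (i : ℕ) :
    complexBetti.map (𝒥.pushforward 𝒥 α).hom.hom.hom i ≫ complexBetti.map (𝒥.abelJacobi P) i =
      complexBetti.map (𝒥.abelJacobi P) i ≫ complexBetti.map α i := by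
  rw [← complexBetti.map_comp, 𝒥.abelJacobi_comp_pushforward 𝒥 α P, complexBetti.map_comp,
    complexBetti_map_abelJacobi_eq 𝒥 P (P ≫ α)]

/-- `dim_ℂ Hⁱ(X(ℂ); ℂ) = dim_ℚ Hⁱ(X(ℂ); ℚ)` (universal coefficients over fields of characteristic
`0`). [cite: HatcherAT2002, §3.1 Thm. 3.2 and §3.A Cor. 3A.6] -/
theorem finrank_complexBetti_eq_finrank_bettiCohomology (X : Motives.SchemeOver ℂ) (i : ℕ) :
    Module.finrank ℂ (complexBetti X i) = Module.finrank ℚ (Motives.bettiCohomology X i) := by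
  change Module.finrank ℂ (singularCohomology ℂ ℂ (Motives.ComplexPoints X) i) =
    Module.finrank ℚ (singularCohomology ℚ ℚ (Motives.ComplexPoints X) i)
  rw [finrank_singularCohomology_eq_bettiNumber_of_field, finrank_singularCohomology_eq_bettiNumber_of_field,
    bettiNumber_eq_of_algebra ℚ ℂ]

/-- **`(f^P)^* : H¹(J(ℂ); ℂ) → H¹(C(ℂ); ℂ)` is bijective**, granted the named fact
`Motives.isIso_bettiCohomology_map_abelJacobi` (the same over `ℚ`): it is injective over any field
of characteristic `0` (`(f^P)_* π₁(C(ℂ))` has finite index in `π₁(J(ℂ))`, the tree's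
`index_range_map_abelJacobi_ne_zero`), and the dimensions agree by the fact.
[cite: Lange2023AbelianVarietiesC, §4.1.1 and Lemma 4.4.1 (proof)] -/
theorem bijective_complexBetti_map_abelJacobi (hI : Motives.isIso_bettiCohomology_map_abelJacobi)
    (hC : Motives.IsSmoothProjective 1 C) (P : Motives.AlgPoints C ℂ) :
    Function.Bijective (complexBetti.map (𝒥.abelJacobi P) 1) := by
  haveI := finite_complexBetti_of_isSmoothProjective hC 1
  haveI := finite_complexBetti_abelianVariety 𝒥.J 1
  have hinj : Function.Injective (complexBetti.map (𝒥.abelJacobi P) 1) :=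
    (singularCohomology_map_injective_iff_of_field ℂ _ 1).mpr
      (singularHomology.map_one_surjective_of_index_ne_zero (Y := 𝒥.J.Points ℂ) ℂ
        (Motives.AlgPoints.mapContinuous (L := ℂ) (𝒥.abelJacobi P)) P
        (Motives.Jacobian.index_range_map_abelJacobi_ne_zero hC 𝒥 P))
  haveI := hI C hC 𝒥 P
  have heq : Module.finrank ℂ (complexBetti 𝒥.J.X 1) = Module.finrank ℂ (complexBetti C 1) := by
    rw [finrank_complexBetti_eq_finrank_bettiCohomology, finrank_complexBetti_eq_finrank_bettiCohomology]
    exact LinearEquiv.finrank_eq (asIso (Motives.bettiCohomology.map (𝒥.abelJacobi P) 1)).toLinearEquiv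
  exact ⟨hinj, (LinearMap.injective_iff_surjective_of_finrank_eq_finrank heq).mp hinj⟩

/-- **`tr ((s^*)ʲ | H¹(J(ℂ); ℂ)) = tr ((α^*)ʲ | H¹(C(ℂ); ℂ))`** for `s = α_*`, granted the named fact
`Motives.isIso_bettiCohomology_map_abelJacobi`: `s^*` and `α^*` are intertwined by the bijection
`(f^P)^*` (Lange §4.5.2 and Lemma 4.4.1: on `H¹(J, ℤ) = H¹(C, ℤ)` the norm map of `α` acts as `α`).
[cite: Lange2023AbelianVarietiesC, §4.5.2 and Lemma 4.4.1 (proof)] -/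
theorem trace_pow_complexBetti_map_pushforward_eq (hI : Motives.isIso_bettiCohomology_map_abelJacobi)
    (hC : Motives.IsSmoothProjective 1 C) (α : C ⟶ C) (j : ℕ) :
    LinearMap.trace ℂ _ ((complexBetti.map (𝒥.pushforward 𝒥 α).hom.hom.hom 1).hom ^ j) =
      LinearMap.trace ℂ _ ((complexBetti.map α 1).hom ^ j) := by
  haveI := finite_complexBetti_of_isSmoothProjective hC 1
  haveI := finite_complexBetti_abelianVariety 𝒥.J 1
  obtain ⟨P⟩ : Nonempty (Motives.AlgPoints C ℂ) := Motives.nonempty_algPoints_of_isSmoothProjective hC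
  have hsq := complexBetti_map_pushforward_comp_map_abelJacobi 𝒥 α P 1
  have h : (complexBetti.map (𝒥.abelJacobi P) 1).hom ∘ₗ (complexBetti.map (𝒥.pushforward 𝒥 α).hom.hom.hom 1).hom =
      (complexBetti.map α 1).hom ∘ₗ (complexBetti.map (𝒥.abelJacobi P) 1).hom := by
    rw [← ModuleCat.hom_comp, hsq, ModuleCat.hom_comp]
  exact trace_pow_eq_of_comp_eq (bijective_complexBetti_map_abelJacobi 𝒥 hI hC P) h j

end JacobianSide

/-! ### §3b From the Lefschetz fixed point theorem to the traces of `α, …, α⁵` -/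

section Lefschetz

variable {C : Motives.SchemeOver ℂ}

/-- The Lefschetz number of a fixed-point-free `β = αʲ` on the closed surface `C(ℂ)`, read on the
powers of `α^*`: `tr((α^*)ʲ|H⁰) - tr((α^*)ʲ|H¹) + tr((α^*)ʲ|H²) = 0`, granted the Lefschetz fixed
point theorem for compact manifolds (hypothesis `hLFT`: Hatcher Thm. 2C.3 with Ex. 2C.7 and Cor. A.9,
cohomological traces with `ℂ`-coefficients; NOT in the tree). [cite: HatcherAT2002, §2.C Thm. 2C.3] -/
theorem lefschetz_traces_of_forall_ne (hLFT : ∀ (n : ℕ) (M : Type) [TopologicalSpace M] [T2Space M] [CompactSpace M]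
      [ChartedSpace (EuclideanSpace ℝ (Fin n)) M] (f : C(M, M)), (∀ x : M, f x ≠ x) →
      ∑ k ∈ Finset.range (n + 1),
        (-1 : ℂ) ^ k * LinearMap.trace ℂ _ (singularCohomology.map ℂ ℂ f k).hom = 0)
    (hC : Motives.IsSmoothProjective 1 C) {α β : C ⟶ C} {j : ℕ}
    (hβ : ∀ k, (complexBetti.map β k).hom = (complexBetti.map α k).hom ^ j)
    (hβfree : ∀ x : Motives.ComplexPoints C, x ≫ β ≠ x) :
    LinearMap.trace ℂ _ ((complexBetti.map α 0).hom ^ j) -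
        LinearMap.trace ℂ _ ((complexBetti.map α 1).hom ^ j) +
        LinearMap.trace ℂ _ ((complexBetti.map α 2).hom ^ j) = 0 := by
  letI := hC.chartedSpace
  haveI := ComplexPoints.compactSpace_of_isSmoothProjective hC
  haveI := ComplexPoints.t2Space_of_isSmoothProjective hC
  have h := hLFT (2 * 1) (Motives.ComplexPoints C) (Motives.AlgPoints.mapContinuous (L := ℂ) β)
    (fun x hx => hβfree x hx)
  rw [show 2 * 1 + 1 = 3 from rfl, Finset.sum_range_succ, Finset.sum_range_succ,
    Finset.sum_range_succ, Finset.sum_range_zero] at h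
  change 0 + (-1 : ℂ) ^ 0 * LinearMap.trace ℂ _ (complexBetti.map β 0).hom +
    (-1 : ℂ) ^ 1 * LinearMap.trace ℂ _ (complexBetti.map β 1).hom +
    (-1 : ℂ) ^ 2 * LinearMap.trace ℂ _ (complexBetti.map β 2).hom = 0 at h
  rw [hβ 0, hβ 1, hβ 2] at h
  linear_combination h

/-- **The Lefschetz numbers of `α, …, α⁵` vanish** for an automorphism `α` with `α⁶ = 𝟙` whose
powers `α²`, `α³` have no fixed complex point (then none of `α, …, α⁵` has one), granted the
Lefschetz fixed point theorem for compact manifolds (hypothesis `hLFT`, NOT in the tree): the hypothesis `hL` of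
`dim_kerComponent_cyclotomic₆_pushforward_eq_eight`. [cite: HatcherAT2002, §2.C Thm. 2C.3] -/
theorem lefschetz_traces_of_pow_six (hLFT : ∀ (n : ℕ) (M : Type) [TopologicalSpace M] [T2Space M] [CompactSpace M]
      [ChartedSpace (EuclideanSpace ℝ (Fin n)) M] (f : C(M, M)), (∀ x : M, f x ≠ x) →
      ∑ k ∈ Finset.range (n + 1),
        (-1 : ℂ) ^ k * LinearMap.trace ℂ _ (singularCohomology.map ℂ ℂ f k).hom = 0)
    (hC : Motives.IsSmoothProjective 1 C) (α : C ⟶ C) (hα : α ≫ α ≫ α ≫ α ≫ α ≫ α = 𝟙 C)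
    (hfree : ∀ P : Motives.ComplexPoints C, P ≫ (α ≫ α) ≠ P ∧ P ≫ (α ≫ α ≫ α) ≠ P) :
    ∀ j : ℕ, 1 ≤ j → j ≤ 5 →
      LinearMap.trace ℂ _ ((complexBetti.map α 0).hom ^ j) -
        LinearMap.trace ℂ _ ((complexBetti.map α 1).hom ^ j) +
        LinearMap.trace ℂ _ ((complexBetti.map α 2).hom ^ j) = 0 := by
  -- `α` itself has no fixed point
  have h1 : ∀ x : Motives.ComplexPoints C, x ≫ α ≠ x := by
    intro x hx
    apply (hfree x).1
    rw [← Category.assoc, hx, hx]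
  intro j hj1 hj5
  interval_cases j
  · exact lefschetz_traces_of_forall_ne hLFT hC (β := α) (fun k => by rw [pow_one]) h1
  · refine lefschetz_traces_of_forall_ne hLFT hC (β := α ≫ α) (fun k => ?_) fun x => (hfree x).1
    simp only [complexBetti_map_comp_hom', pow_succ, pow_zero, Module.End.one_eq_id,
      LinearMap.id_comp, Module.End.mul_eq_comp]
  · refine lefschetz_traces_of_forall_ne hLFT hC (β := α ≫ α ≫ α) (fun k => ?_) fun x => (hfree x).2
    simp only [complexBetti_map_comp_hom', pow_succ, pow_zero, Module.End.one_eq_id,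
      LinearMap.id_comp, Module.End.mul_eq_comp, LinearMap.comp_assoc]
  · refine lefschetz_traces_of_forall_ne hLFT hC (β := α ≫ α ≫ α ≫ α) (fun k => ?_) fun x hx => ?_
    · simp only [complexBetti_map_comp_hom', pow_succ, pow_zero, Module.End.one_eq_id,
        LinearMap.id_comp, Module.End.mul_eq_comp, LinearMap.comp_assoc]
    · -- `x α⁴ = x ⇒ x α² = x α⁸ = x α⁴ = x`... via `α⁶ = 𝟙`: `x α² = (x α⁴) α² = x α⁶ = x`
      apply (hfree x).1
      calc x ≫ α ≫ α = (x ≫ α ≫ α ≫ α ≫ α) ≫ α ≫ α := by rw [hx]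
        _ = x ≫ (α ≫ α ≫ α ≫ α ≫ α ≫ α) := by simp only [Category.assoc]
        _ = x := by rw [hα, Category.comp_id]
  · refine lefschetz_traces_of_forall_ne hLFT hC (β := α ≫ α ≫ α ≫ α ≫ α) (fun k => ?_) fun x hx => ?_
    · simp only [complexBetti_map_comp_hom', pow_succ, pow_zero, Module.End.one_eq_id,
        LinearMap.id_comp, Module.End.mul_eq_comp, LinearMap.comp_assoc]
    · -- `x α⁵ = x ⇒ x α = (x α⁵) α = x α⁶ = x`
      apply h1 x
      calc x ≫ α = (x ≫ α ≫ α ≫ α ≫ α ≫ α) ≫ α := by rw [hx]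
        _ = x ≫ (α ≫ α ≫ α ≫ α ≫ α ≫ α) := by simp only [Category.assoc]
        _ = x := by rw [hα, Category.comp_id]

end Lefschetz

/-! ### §4 Assembly: `dim B = 8` and Schoen's fact from its two remaining inputs -/

section Assembly

variable {C : Motives.SchemeOver ℂ} (𝒥 : Jacobian C)

/-- `(g^*)` of `g = 𝟙 - s + s²` on `H¹` is `1 - S + S²`, `S = s^*`. [folklore] -/
theorem complexBetti_map_cyclotomic₆_one_hom {J : Motives.AbelianVariety ℂ} (s : J ⟶ J) :
    (complexBetti.map (𝟙 J - s + s ≫ s).hom.hom.hom 1).hom =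
      1 - (complexBetti.map s.hom.hom.hom 1).hom + (complexBetti.map s.hom.hom.hom 1).hom ^ 2 := by
  rw [complexBetti_map_add_one, complexBetti_map_sub_one, complexBetti_map_comp_hom,
    ModuleCat.hom_add, ModuleCat.hom_sub, ModuleCat.hom_comp]
  change (complexBetti.map (𝟙 J.X) 1).hom - _ + _ = _
  rw [complexBetti.map_id, ModuleCat.hom_id, ← Module.End.one_eq_id, pow_two, Module.End.mul_eq_comp]

/-- `(s^*)⁶ = 1` on `H¹` for `s⁶ = 𝟙`. [folklore] -/
theorem complexBetti_map_one_hom_pow_six {J : Motives.AbelianVariety ℂ} {s : J ⟶ J}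
    (hs6 : s ≫ s ≫ s ≫ s ≫ s ≫ s = 𝟙 J) : (complexBetti.map s.hom.hom.hom 1).hom ^ 6 = 1 := by
  have h := congrArg (fun t : J ⟶ J => (complexBetti.map t.hom.hom.hom 1).hom) hs6
  dsimp only at h
  iterate 5 rw [complexBetti_map_comp_hom] at h
  simp only [ModuleCat.hom_comp] at h
  change _ = (complexBetti.map (𝟙 J.X) 1).hom at h
  rw [complexBetti.map_id, ModuleCat.hom_id, ← Module.End.one_eq_id] at h
  rw [← h]
  simp only [pow_succ, pow_zero, one_mul, Module.End.mul_eq_comp, LinearMap.comp_assoc]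

/-- **`dim B = 8` for Schoen's primitive Prym `B = (Ker (𝟙 - α_* + α_*²))⁰`** of an étale `ℤ/6`-cover
of a genus-`5` curve (`g(C) = 25`), from (i) the named fact `H¹(J(C)) ≅ H¹(C)`
(`Motives.isIso_bettiCohomology_map_abelJacobi`) and (ii) the LEFSCHETZ NUMBERS of `α, …, α⁵`:
`tr(H⁰) - tr(H¹) + tr(H²) = 0` for the fixed-point-free `αʲ` (Lefschetz fixed-point theorem, Hatcher
Thm. 2C.3 — the hypothesis `hL`; not in the tree). Then `tr((α^*)ʲ | H¹) = 1 + λʲ` with `λ = ±1`,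
Chevalley–Weil gives multiplicity `16` to the primitive sixth roots of unity in `H¹(J)`
(Patel–Zhang Lemma 2.9 / 5.1: every primitive character occurs `h = 8` times; Schoen Lemma 1.5), and
`2 dim B = dim ker Φ₆(s^*) = 16` (`two_mul_dim_kerComponent_eq_finrank_ker`).
[cite: PatelZhang2025PrymHodge, Lemma 2.9 and Lemma 5.1] [cite: Schoen1988HodgeWeil, Lemma 1.5]
[cite: HatcherAT2002, §2.C Thm. 2C.3] -/
theorem dim_kerComponent_cyclotomic₆_pushforward_eq_eight
    (hI : Motives.isIso_bettiCohomology_map_abelJacobi) (α : C ⟶ C)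
    (hC : Motives.IsSmoothProjective 1 C) (h25 : 𝒥.J.dim = 25) (hα : α ≫ α ≫ α ≫ α ≫ α ≫ α = 𝟙 C)
    (hL : ∀ j : ℕ, 1 ≤ j → j ≤ 5 →
      LinearMap.trace ℂ _ ((complexBetti.map α 0).hom ^ j) -
        LinearMap.trace ℂ _ ((complexBetti.map α 1).hom ^ j) +
        LinearMap.trace ℂ _ ((complexBetti.map α 2).hom ^ j) = 0)
    {s : 𝒥.J ⟶ 𝒥.J} (hs : s = 𝒥.pushforward 𝒥 α) :
    (Motives.AbelianVariety.kerComponent (𝟙 𝒥.J - s + s ≫ s)).dim = 8 := by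
  haveI := finite_complexBetti_abelianVariety 𝒥.J 1
  set S := (complexBetti.map s.hom.hom.hom 1).hom with hSdef
  -- `2 dim B = dim ker (1 - S + S²)`
  have hD := two_mul_dim_kerComponent_eq_finrank_ker (𝟙 𝒥.J - s + s ≫ s)
  rw [complexBetti_map_cyclotomic₆_one_hom, ← hSdef] at hD
  -- `S⁶ = 1`, `dim H¹(J) = 50`
  have hS6 : S ^ 6 = 1 := complexBetti_map_one_hom_pow_six (pushforward_comp_pow_six_of_pow_six 𝒥 hα hs)
  have h50 : Module.finrank ℂ (complexBetti 𝒥.J.X 1) = 50 := by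
    rw [Motives.AbelianVariety.finrank_complexBetti_one, h25]
  -- the traces
  set l := LinearMap.trace ℂ _ (complexBetti.map α 2).hom with hl
  have hl2 : l ^ 2 = 1 := sq_trace_complexBetti_map_two_eq_one hC α hα
  have htr : ∀ j : ℕ, 1 ≤ j → j ≤ 5 → LinearMap.trace ℂ _ (S ^ j) = 1 + l ^ j := by
    intro j hj1 hj5
    rw [hSdef, hs, trace_pow_complexBetti_map_pushforward_eq 𝒥 hI hC α j]
    have h := hL j hj1 hj5
    rw [trace_pow_complexBetti_map_zero hC α j, trace_pow_complexBetti_map_two_of_curve hC α j] at h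
    linear_combination (-1 : ℂ) * h
  have h16 := finrank_ker_cyclotomic₆_eq_sixteen S hS6 h50 hl2 htr
  omega

/-- **Schoen's fact from its two remaining inputs.** The named fact
`Schoen1988_cyclicPrym_weilClasses_algebraic_degreeSix` follows from
(i) the named fact `Motives.isIso_bettiCohomology_map_abelJacobi` (`H¹(J(C)) ≅ H¹(C)`, Lange §4.1.1),
(ii) the LEFSCHETZ NUMBERS of the fixed-point-free `α, …, α⁵` on `C(ℂ)` vanish — the conclusion of the
Lefschetz fixed-point theorem (Hatcher Thm. 2C.3) for these maps, NOT in the tree — and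
(iii) Schoen's cycle: ONE non-zero algebraic class in the Weil line `E₊` of `(B, ψ₀)` (Schoen Thm. 2.0
with Cor. 3.1; Patel–Zhang Prop. 3.2–Thm. 4.4; NOT in the tree). (i)+(ii) give `dim B = 8`
(`dim_kerComponent_cyclotomic₆_pushforward_eq_eight`), and the typing brick
`Schoen1988_cyclicPrym_weilClasses_algebraic_degreeSix_of_dim_eq_eight_of_exists` concludes.
[cite: Schoen1988HodgeWeil, Cor. 3.1 (p. 24), Thm. 2.0 (p. 11), Lemma 1.5]
[cite: PatelZhang2025PrymHodge, Lemma 2.9, Lemma 5.1, Thm 4.4, Thm 5.3] [cite: HatcherAT2002, §2.C Thm. 2C.3] -/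
theorem Schoen1988_cyclicPrym_weilClasses_algebraic_degreeSix_of_isIso_of_lefschetz_of_exists
    (hI : Motives.isIso_bettiCohomology_map_abelJacobi)
    (hL : ∀ (C : Motives.SchemeOver ℂ) (α : C ⟶ C), Motives.IsSmoothProjective 1 C →
      α ≫ α ≫ α ≫ α ≫ α ≫ α = 𝟙 C →
      (∀ P : Motives.ComplexPoints C, P ≫ (α ≫ α) ≠ P ∧ P ≫ (α ≫ α ≫ α) ≠ P) →
      ∀ j : ℕ, 1 ≤ j → j ≤ 5 →
        LinearMap.trace ℂ _ ((complexBetti.map α 0).hom ^ j) -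
          LinearMap.trace ℂ _ ((complexBetti.map α 1).hom ^ j) +
          LinearMap.trace ℂ _ ((complexBetti.map α 2).hom ^ j) = 0)
    (hZ : ∀ (C : Motives.SchemeOver ℂ) (𝒥 : Jacobian C) (α : C ⟶ C),
      Motives.IsSmoothProjective 1 C → 𝒥.J.dim = 25 →
      α ≫ α ≫ α ≫ α ≫ α ≫ α = 𝟙 C →
      (∀ P : Motives.ComplexPoints C, P ≫ (α ≫ α) ≠ P ∧ P ≫ (α ≫ α ≫ α) ≠ P) →
    ∀ (s : 𝒥.J ⟶ 𝒥.J), s = 𝒥.pushforward 𝒥 α →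
    ∀ (sB ψ₀ : Motives.AbelianVariety.kerComponent (𝟙 𝒥.J - s + s ≫ s) ⟶
        Motives.AbelianVariety.kerComponent (𝟙 𝒥.J - s + s ≫ s)),
      sB ≫ Motives.AbelianVariety.kerComponentι (𝟙 𝒥.J - s + s ≫ s) =
        Motives.AbelianVariety.kerComponentι (𝟙 𝒥.J - s + s ≫ s) ≫ s →
      ψ₀ = 𝟙 _ + 2 • (sB ≫ sB) →
      ∃ c ∈ weilClassesPlus (Motives.AbelianVariety.kerComponent (𝟙 𝒥.J - s + s ≫ s)) ψ₀ 4 3,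
        c ∈ algebraicClasses (Motives.AbelianVariety.kerComponent (𝟙 𝒥.J - s + s ≫ s)).X 4 ∧ c ≠ 0) :
    Schoen1988_cyclicPrym_weilClasses_algebraic_degreeSix :=
  Schoen1988_cyclicPrym_weilClasses_algebraic_degreeSix_of_dim_eq_eight_of_exists
    fun C 𝒥 α hC h25 hα hfree s hs sB ψ₀ hsB hψ₀ =>
      ⟨dim_kerComponent_cyclotomic₆_pushforward_eq_eight 𝒥 hI α hC h25 hα (hL C α hC hα hfree) hs,
        hZ C 𝒥 α hC h25 hα hfree s hs sB ψ₀ hsB hψ₀⟩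

/-- **Schoen's fact from `H¹(J) ≅ H¹(C)`, the Lefschetz fixed point theorem, and Schoen's cycle**: the
same as `…_of_isIso_of_lefschetz_of_exists` with the curve-specific Lefschetz hypothesis supplied by the
Lefschetz fixed point theorem for compact manifolds, taken as the hypothesis `hLFT` in the shape of
Hatcher's Thm. 2C.3 (with Ex. 2C.7, field coefficients, and Cor. A.9, compact manifolds; contrapositive,
cohomological traces): for a compact Hausdorff topological `n`-manifold `M` and a fixed-point-free
`f : M → M`, `Σ_{k ≤ n} (-1)ᵏ tr(f^* | Hᵏ(M; ℂ)) = 0` — a classical theorem ABSENT from the tree (it may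
not be minted as a named fact from this proving unit, D-0026), through `lefschetz_traces_of_pow_six`.
[cite: Schoen1988HodgeWeil, Cor. 3.1 (p. 24) with Thm. 2.0] [cite: HatcherAT2002, §2.C Thm. 2C.3] -/
theorem Schoen1988_cyclicPrym_weilClasses_algebraic_degreeSix_of_isIso_of_lefschetzFixedPoint_of_exists
    (hI : Motives.isIso_bettiCohomology_map_abelJacobi)
    (hLFT : ∀ (n : ℕ) (M : Type) [TopologicalSpace M] [T2Space M] [CompactSpace M]
      [ChartedSpace (EuclideanSpace ℝ (Fin n)) M] (f : C(M, M)), (∀ x : M, f x ≠ x) →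
      ∑ k ∈ Finset.range (n + 1),
        (-1 : ℂ) ^ k * LinearMap.trace ℂ _ (singularCohomology.map ℂ ℂ f k).hom = 0)
    (hZ : ∀ (C : Motives.SchemeOver ℂ) (𝒥 : Jacobian C) (α : C ⟶ C),
      Motives.IsSmoothProjective 1 C → 𝒥.J.dim = 25 →
      α ≫ α ≫ α ≫ α ≫ α ≫ α = 𝟙 C →
      (∀ P : Motives.ComplexPoints C, P ≫ (α ≫ α) ≠ P ∧ P ≫ (α ≫ α ≫ α) ≠ P) →
    ∀ (s : 𝒥.J ⟶ 𝒥.J), s = 𝒥.pushforward 𝒥 α →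
    ∀ (sB ψ₀ : Motives.AbelianVariety.kerComponent (𝟙 𝒥.J - s + s ≫ s) ⟶
        Motives.AbelianVariety.kerComponent (𝟙 𝒥.J - s + s ≫ s)),
      sB ≫ Motives.AbelianVariety.kerComponentι (𝟙 𝒥.J - s + s ≫ s) =
        Motives.AbelianVariety.kerComponentι (𝟙 𝒥.J - s + s ≫ s) ≫ s →
      ψ₀ = 𝟙 _ + 2 • (sB ≫ sB) →
      ∃ c ∈ weilClassesPlus (Motives.AbelianVariety.kerComponent (𝟙 𝒥.J - s + s ≫ s)) ψ₀ 4 3,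
        c ∈ algebraicClasses (Motives.AbelianVariety.kerComponent (𝟙 𝒥.J - s + s ≫ s)).X 4 ∧ c ≠ 0) :
    Schoen1988_cyclicPrym_weilClasses_algebraic_degreeSix :=
  Schoen1988_cyclicPrym_weilClasses_algebraic_degreeSix_of_isIso_of_lefschetz_of_exists hI
    (fun _ α hC hα hfree => lefschetz_traces_of_pow_six hLFT hC α hα hfree) hZ

end Assembly

end Literature.AlgebraicGeometry.HodgeTheory

end
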